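import Mathlib
import HarnessLib
import Summits.ValiantsHypothesis.ValiantsHypothesis.Theses.MonotoneRestoration
import Literature.Computability.AlgebraicComplexity.SymmetricCircuitPullback

/-! # Route MonotoneRestoration — crux `MonotoneRestorationQP`, line Sketch, stub Z9
(stmt-ValiantsHypothesis-15886)

**Pull-back of an equivariant output family along an equivariant index map.** If a
`Γ`-symmetric Dawar–Wilsenach labelled arithmetic circuit over the constants `K` and the
variables `X` computes a family `(g_y)_{y ∈ Y}` at outputs indexed by the `Γ`-set `Y`, and
`e : Y' → Y` is a `Γ`-equivariant (not necessarily injective) map from a finite `Γ`-set `Y'`, then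
the pulled-back family `(g_{e y'})_{y' ∈ Y'}` is computed at outputs indexed by `Y'` by a
`Γ`-symmetric circuit on at most `|G| + |Y'|` gates. (Output gates are injectively indexed, so a
non-injective re-indexing costs one unary `+` copy gate per new index.)

Proof: the universe-`0` instance of the tree lemma
`LabelledArithCircuit.IsSymmetric.exists_pullback`
(`Literature/Computability/AlgebraicComplexity/SymmetricCircuitPullback.lean`): gate set `G ⊕ Y'`,
one new unary addition gate `Sum.inr y'` per index over the output gate indexed `e y'`; an
automorphism `π` extending `γ` extends as `π ⊕ (γ • ·)` because `e (γ • y') = γ • e y'`.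
-/

noncomputable section

-- `Summit.ValiantsHypothesis.ValiantsHypothesis.…` is the tree's mandated namespace (Sub = Summit).
set_option linter.dupNamespace false

namespace Summit.ValiantsHypothesis.ValiantsHypothesis.Theorems

open Literature.Computability.AlgebraicComplexity

/-- **Z9 — pull-back of an equivariant output family along an equivariant index map** (crux
`MonotoneRestorationQP`, line Sketch; registered stub `stub_symmetric_pullbackOutputs`): if a
`Γ`-symmetric circuit computes `(g_y)_{y ∈ Y}` and `e : Y' → Y` is `Γ`-equivariant, then
`(g_{e y'})_{y' ∈ Y'}` is computed at outputs indexed by `Y'` by a `Γ`-symmetric circuit on at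
most `|G| + |Y'|` gates (one unary `+` copy gate per `y'` over the output gate `e y'`).
Instance of `LabelledArithCircuit.IsSymmetric.exists_pullback`. -/
theorem stub_symmetric_pullbackOutputs {K X Y Y' Γ G : Type} [CommSemiring K] [Group Γ]
    [MulAction Γ X] [MulAction Γ Y] [MulAction Γ Y'] [Fintype Y'] [Fintype G]
    (C : LabelledArithCircuit K X Y G) (hC : C.IsSymmetric Γ) (e : Y' → Y)
    (he : ∀ (γ : Γ) (y' : Y'), e (γ • y') = γ • e y') :
    ∃ (G' : Type) (_ : Fintype G') (C' : LabelledArithCircuit K X Y' G'),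
      C'.IsSymmetric Γ ∧
      (∀ y', C'.eval (C'.output y') = C.eval (C.output (e y'))) ∧
      Fintype.card G' ≤ Fintype.card G + Fintype.card Y' :=
  hC.exists_pullback e he

end Summit.ValiantsHypothesis.ValiantsHypothesis.Theorems

end
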